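import Literature.NumberTheory.Sieve.HeathBrownCubicPolarCount
import Mathlib.MeasureTheory.Function.Jacobian
import Mathlib.Analysis.SpecialFunctions.Trigonometric.Bounds
import HarnessLib

/-!
# Twisted lattice sums of `ℤ[∛2]` in sectors: a power saving for Grössencharakter sums

Continuation of `HeathBrownCubicPolar` / `HeathBrownCubicPolarCount`. The goal is the analytic
input for T. Mitsui's prime number theorem with Grössencharakteren for `K = ℚ(∛2)` (Jap. J. Math.
26 (1956), Lemma 5) = Lemma 9.4 of D. R. Heath-Brown, *Primes represented by `x³ + 2y³`*, Acta
Math. 186 (2001), §9: the partial sums of a NONTRIVIAL torus character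
`ψ_{j,κ}(β) = e^{ij arg β'} e(−κ log(β/N(β)^{1/3})/log ε₀)` (Heath-Brown's `ν₁^j ν₂^k`, (9.2), up to
normalisation) over the canonical generators `β ≡ α (mod q)` of norm `≤ x` are
`O((1+|j|+|κ|) x^{8/9})`, uniformly in the modulus `q` and the class `α` — which, fed into
`LSeriesContinuationOfPartialSums` (θ = 8/9), continues the twisted `L`-functions to `σ > 8/9` with
polynomial growth in the conductor. Everything here is PROVED; the definitions (`paramW`, `polarMapW`,
`sectorIoc`, `charW`, `charRef`, `CongMod`, `congEquiv`, `cellLo`, `cellHi`, `cellIdx`) have bodies.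

* **Null faces, half-open cells** (`volume_image_polarMap_eq_zero`: a `C¹` self-map of `W` kills
  null sets, applied through the reparametrisation `polarMapW ∘ paramW = polarMap`; the faces
  `u = u₀`, `r = r₀`, `φ = φ₀` are null in `W`): the half-open cells
  `sectorIoc a b = polarMap((0,1] × (a₁,b₁] × (a₂,b₂])` have the volume of the closed sectors
  (`volume_sectorIoc`), the same frontier bound, and hence the same UNIFORM lattice count
  `exists_uniform_sectorIoc_count`; they partition the fundamental region exactly.
* **Characters** `charW j κ`, unit modulus, variation `≤ |j|δ + 2π|κ|δ'` on a cell
  (`norm_charW_sub_charRef_le`), scale invariance (`charW_smul`), `τ•F ⊆ F` for `τ ≤ 1`;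
  `sum_range_exp_eq_zero`: `∑_{i<M} e^{im(θ₀ + c(i+1))} = 0` for `0 < |m| < M`, `cM = 2π`.
* **Congruence classes** `CongMod q a v` (`v ≡ a mod q` on `ℤ³`) and the bijection `congEquiv`
  `v = a + qu`: `card_cong_eq` — the class meets `t·X` in `#(𝓞_K ∩ ((t/q)·X − q⁻¹â))` points.
* **Cells** `cellLo/cellHi M i l` (a uniform `M × M` grid of `(0,1] × (−π,π]`), all of the same
  volume (`volume_sector_cell`, from `volume_sector_add`), the index `cellIdx` and its fibres
  (`mem_cell_iff_cellIdx`, `cellIdx_eq_iff_mem_smul_cell`), `sum_charRef_eq_zero` (the reference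
  values cancel over the grid when `0 < |j| < M`, or `j = 0`, `κ = k`, `0 < |k| < M`).
* **Main theorem** `exists_twisted_sum_bound`: ONE absolute `C` with
  `‖∑_{v ∈ T} ψ_{j,κ}(embW v̂)‖ ≤ C (1 + |j| + |κ|) t^{8/3}` for all `j, κ` with `j ≠ 0` or
  `κ ∈ ℤ∖{0}`, all `q ≥ 1`, `a`, `t ≥ 1`, where `T = {v ≡ a (q) : embW v̂ ∈ t·F}`
  (`F = sectorIoc (0,−π) (1,π)`: norm `≤ 1`, unit coordinate in `(0,1]` = the window `InWindow`,
  so `T` is the set of canonical generators of norm `≤ t³` in the class). Proof: `M ≍ t^{1/3}`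
  cells; per cell the uniform count and the variation bound (`cell_estimates`); the main terms
  cancel exactly; `twisted_endgame` does the arithmetic; small scales (`t < q`) and huge frequencies
  (`|j|+|κ| > t^{2/3}`) by the trivial bound.

## References

* D. R. Heath-Brown, *Primes represented by `x³ + 2y³`*, Acta Math. 186 (2001), §9 (9.2), Lemma 9.4.
  [cite: HeathBrownActa2001, §9 Lemma 9.4]
* T. Mitsui, *Generalized prime number theorem*, Jap. J. Math. 26 (1956), 1–42, Lemma 5.
  [cite: Mitsui1956, Lemma 5]
* E. Hecke, *Eine neue Art von Zetafunktionen und ihre Beziehungen zur Verteilung der Primzahlen. II*,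
  Math. Z. 6 (1920), 11–51 (equidistribution of ideals in sectors). [folklore]
* D. A. Marcus, *Number Fields*, 2nd ed., Springer 2018, Ch. 6, Lemma 2. [cite: Marcus2018, Ch. 6, Lemma 2]

## Mathlib / tree search

Tree: `HeathBrownCubicPolar`, `HeathBrownCubicPolarCount` (all of it), `castVec`
(`HeathBrownCubicCubeSums`). Mathlib: `MeasureTheory.addHaar_image_eq_zero_of_differentiableOn_of_addHaar_eq_zero`,
`Complex.volume_preserving_equiv_real_prod`, `Measure.prod_prod`, `Real.norm_exp_I_mul_ofReal_sub_one_le`,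
`Complex.exp_eq_one_iff`, `Complex.exp_int_mul_two_pi_mul_I`, `geom_sum_eq`, `ZSpan.setFinite_inter`,
`Finset.sum_fiberwise_of_maps_to`, `Finset.card_eq_sum_card_fiberwise`, `Nat.ceil` API. No sector
equidistribution / Hecke character sums existed in the tree (`lean search 'Grössen|Hecke.*sector|charW'`).
-/

noncomputable section

open Complex Set Metric MeasureTheory Module Submodule
open scoped NNReal Pointwise

namespace Literature.NumberTheory.Sieve.CubicSieve

/-! ## Null faces, half-open cells and their uniform count -/

/-- The parameters seen inside `W`: `(u, r, φ) ↦ (u, r + iφ)`. [folklore] -/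
def paramW (p : ℝ × ℝ × ℝ) : ℝ × ℂ := (p.1, ⟨p.2.1, p.2.2⟩)

/-- The polar map factored through `W`: `polarMapW (u, z) = polarMap (u, Re z, Im z)`. [folklore] -/
def polarMapW (z : ℝ × ℂ) : ℝ × ℂ := polarMap (z.1, z.2.re, z.2.im)

/-- `polarMap = polarMapW ∘ paramW`. [folklore] -/
theorem polarMapW_paramW (p : ℝ × ℝ × ℝ) : polarMapW (paramW p) = polarMap p := rfl

/-- `polarMap '' s = polarMapW '' (paramW '' s)`. [folklore] -/
theorem image_polarMap_eq (s : Set (ℝ × ℝ × ℝ)) : polarMap '' s = polarMapW '' (paramW '' s) := by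
  rw [Set.image_image]; rfl

/-- `polarMapW` is `C¹`. [folklore] -/
theorem contDiff_polarMapW : ContDiff ℝ 1 polarMapW := by
  unfold polarMapW
  refine (contDiff_polarMap (n := 1)).comp ?_
  exact contDiff_fst.prodMk ((Complex.reCLM.contDiff.comp contDiff_snd).prodMk
    (Complex.imCLM.contDiff.comp contDiff_snd))

/-- **Images of null parameter sets are null**: if `paramW '' s` has measure zero in `W`, so has
`polarMap '' s` (a `C¹` self-map of `W` maps null sets to null sets). [folklore] -/
theorem volume_image_polarMap_eq_zero {s : Set (ℝ × ℝ × ℝ)} (hs : volume (paramW '' s) = 0) :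
    volume (polarMap '' s) = 0 := by
  rw [image_polarMap_eq]
  exact MeasureTheory.addHaar_image_eq_zero_of_differentiableOn_of_addHaar_eq_zero volume
    ((contDiff_polarMapW.differentiable one_ne_zero).differentiableOn) hs

/-- A horizontal line `{Im z = φ₀}` in `ℂ` is null. [folklore] -/
theorem volume_im_eq_zero (φ₀ : ℝ) : volume {z : ℂ | z.im = φ₀} = 0 := by
  have h : {z : ℂ | z.im = φ₀} = Complex.measurableEquivRealProd ⁻¹' (Set.univ ×ˢ {φ₀}) := by
    ext z; simp [Complex.measurableEquivRealProd_apply]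
  rw [h, Complex.volume_preserving_equiv_real_prod.measure_preimage
    (MeasurableSet.univ.prod (measurableSet_singleton φ₀)).nullMeasurableSet,
    Measure.volume_eq_prod, Measure.prod_prod, Real.volume_singleton, mul_zero]

/-- The face `u = u₀` is null in `W`. [folklore] -/
theorem volume_paramW_face_u (u₀ : ℝ) (A : Set (ℝ × ℝ)) : volume (paramW '' ({u₀} ×ˢ A)) = 0 := by
  refine measure_mono_null (t := ({u₀} : Set ℝ) ×ˢ (Set.univ : Set ℂ)) ?_ ?_
  · rintro _ ⟨p, ⟨hp, -⟩, rfl⟩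
    exact ⟨hp, Set.mem_univ _⟩
  · rw [Measure.volume_eq_prod, Measure.prod_prod, Real.volume_singleton, zero_mul]

/-- The face `r = r₀` is null in `W` (a vertical line `{Re z = r₀}` is null in `ℂ`; cf. the
tree's `Automorphic.volume_setOf_re_eq`, not imported here to keep the dependencies light). [folklore] -/
theorem volume_paramW_face_r (r₀ : ℝ) (A C : Set ℝ) : volume (paramW '' (A ×ˢ ({r₀} ×ˢ C))) = 0 := by
  have hline : volume {z : ℂ | z.re = r₀} = 0 := by
    have h : {z : ℂ | z.re = r₀} = Complex.measurableEquivRealProd ⁻¹' ({r₀} ×ˢ Set.univ) := by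
      ext z; simp [Complex.measurableEquivRealProd_apply]
    rw [h, Complex.volume_preserving_equiv_real_prod.measure_preimage
      ((measurableSet_singleton r₀).prod MeasurableSet.univ).nullMeasurableSet,
      Measure.volume_eq_prod, Measure.prod_prod, Real.volume_singleton, zero_mul]
  refine measure_mono_null (t := (Set.univ : Set ℝ) ×ˢ {z : ℂ | z.re = r₀}) ?_ ?_
  · rintro _ ⟨p, ⟨-, hp, -⟩, rfl⟩
    exact ⟨Set.mem_univ _, by simpa [paramW] using hp⟩
  · rw [Measure.volume_eq_prod, Measure.prod_prod, hline, mul_zero]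

/-- The face `φ = φ₀` is null in `W`. [folklore] -/
theorem volume_paramW_face_φ (φ₀ : ℝ) (A B : Set ℝ) : volume (paramW '' (A ×ˢ (B ×ˢ {φ₀}))) = 0 := by
  refine measure_mono_null (t := (Set.univ : Set ℝ) ×ˢ {z : ℂ | z.im = φ₀}) ?_ ?_
  · rintro _ ⟨p, ⟨-, -, hp⟩, rfl⟩
    exact ⟨Set.mem_univ _, by simpa [paramW] using hp⟩
  · rw [Measure.volume_eq_prod, Measure.prod_prod, volume_im_eq_zero, mul_zero]

/-- **The half-open cell** `sectorIoc a b = polarMap '' ((0,1] × (a₁,b₁] × (a₂,b₂])`: with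
`r ∈ (0,1]` the window of generators (`InWindow`) and angles in `(−π, π]`, these cells partition the
fundamental domain exactly. [cite: HeathBrownActa2001, §11 (11.3)] -/
def sectorIoc (a b : ℝ × ℝ) : Set (ℝ × ℂ) :=
  polarMap '' (Set.Ioc (0 : ℝ) 1 ×ˢ (Set.Ioc a.1 b.1 ×ˢ Set.Ioc a.2 b.2))

/-- `sectorIoc a b ⊆ sector a b`. [folklore] -/
theorem sectorIoc_subset_sector (a b : ℝ × ℝ) : sectorIoc a b ⊆ sector a b := by
  refine Set.image_mono ?_
  rintro ⟨u, r, φ⟩ ⟨hu, hr, hφ⟩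
  exact ⟨hu, ⟨⟨hr.1.le, hφ.1.le⟩, ⟨hr.2, hφ.2⟩⟩⟩

/-- The closed box minus the half-open box lies in the three faces `u = 0`, `r = a₁`, `φ = a₂`.
[folklore] -/
theorem Icc_diff_Ioc_subset (a b : ℝ × ℝ) :
    (Set.Icc (0 : ℝ) 1 ×ˢ Set.Icc a b) \ (Set.Ioc (0 : ℝ) 1 ×ˢ (Set.Ioc a.1 b.1 ×ˢ Set.Ioc a.2 b.2)) ⊆
      ({(0 : ℝ)} ×ˢ (Set.univ : Set (ℝ × ℝ))) ∪
        ((Set.univ : Set ℝ) ×ˢ ({a.1} ×ˢ (Set.univ : Set ℝ))) ∪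
        ((Set.univ : Set ℝ) ×ˢ ((Set.univ : Set ℝ) ×ˢ {a.2})) := by
  rintro ⟨u, r, φ⟩ ⟨hmem, hnot⟩
  simp only [Set.mem_prod, Set.mem_Icc, Prod.le_def] at hmem
  obtain ⟨⟨hu0, hu1⟩, ⟨hra, hφa⟩, ⟨hrb, hφb⟩⟩ := hmem
  simp only [Set.mem_prod, Set.mem_Ioc, not_and_or, not_lt, not_le] at hnot
  simp only [Set.mem_union, Set.mem_prod, Set.mem_singleton_iff, Set.mem_univ, and_true, true_and]
  rcases hnot with (hu | hu) | ((hr | hr) | (hφ | hφ))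
  · exact Or.inl (Or.inl (le_antisymm hu hu0))
  · exact absurd hu1 (not_le.2 hu)
  · exact Or.inl (Or.inr (le_antisymm hr hra))
  · exact absurd hrb (not_le.2 hr)
  · exact Or.inr (le_antisymm hφ hφa)
  · exact absurd hφb (not_le.2 hφ)

/-- **The half-open cell has the same volume as the closed sector.** [folklore] -/
theorem volume_sectorIoc (a b : ℝ × ℝ) : volume (sectorIoc a b) = volume (sector a b) := by
  refine le_antisymm (measure_mono (sectorIoc_subset_sector a b)) ?_
  -- `sector ⊆ sectorIoc ∪ polarMap '' (three faces)`
  set F : Set (ℝ × ℝ × ℝ) := ({(0 : ℝ)} ×ˢ (Set.univ : Set (ℝ × ℝ))) ∪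
        ((Set.univ : Set ℝ) ×ˢ ({a.1} ×ˢ (Set.univ : Set ℝ))) ∪
        ((Set.univ : Set ℝ) ×ˢ ((Set.univ : Set ℝ) ×ˢ {a.2})) with hF
  have hnull : volume (polarMap '' F) = 0 := by
    rw [hF, Set.image_union, Set.image_union]
    refine measure_union_null (measure_union_null ?_ ?_) ?_
    · exact volume_image_polarMap_eq_zero (volume_paramW_face_u 0 _)
    · exact volume_image_polarMap_eq_zero (volume_paramW_face_r a.1 _ _)
    · exact volume_image_polarMap_eq_zero (volume_paramW_face_φ a.2 _ _)
  have hsub : sector a b ⊆ sectorIoc a b ∪ polarMap '' F := by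
    rintro w ⟨p, hp, rfl⟩
    by_cases h : p ∈ Set.Ioc (0 : ℝ) 1 ×ˢ (Set.Ioc a.1 b.1 ×ˢ Set.Ioc a.2 b.2)
    · exact Or.inl ⟨p, h, rfl⟩
    · refine Or.inr ⟨p, Icc_diff_Ioc_subset a b ⟨?_, h⟩, rfl⟩
      exact ⟨⟨hp.1.1.le, hp.1.2⟩, hp.2⟩
  calc volume (sector a b) ≤ volume (sectorIoc a b ∪ polarMap '' F) := measure_mono hsub
    _ ≤ volume (sectorIoc a b) + volume (polarMap '' F) := measure_union_le _ _
    _ = volume (sectorIoc a b) := by rw [hnull, add_zero]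

/-- The frontier of the half-open cell lies in `polarMap(∂ box)` too (angles in `[−π, π]`).
[folklore] -/
theorem frontier_sectorIoc_subset {a b : ℝ × ℝ} (ha : -Real.pi ≤ a.2) (hb : b.2 ≤ Real.pi) :
    frontier (sectorIoc a b) ⊆
      polarMap '' ((Set.Icc (0 : ℝ) 1 ×ˢ Set.Icc a b) \
        (Set.Ioo (0 : ℝ) 1 ×ˢ (Set.Ioo a.1 b.1 ×ˢ Set.Ioo a.2 b.2))) := by
  have hcl : closure (sectorIoc a b) ⊆ polarMap '' (Set.Icc (0 : ℝ) 1 ×ˢ Set.Icc a b) :=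
    closure_minimal ((sectorIoc_subset_sector a b).trans (sector_subset_image_Icc a b))
      (((isCompact_Icc.prod isCompact_Icc).image continuous_polarMap).isClosed)
  have hint : polarMap '' (Set.Ioo (0 : ℝ) 1 ×ˢ (Set.Ioo a.1 b.1 ×ˢ Set.Ioo a.2 b.2)) ⊆
      interior (sectorIoc a b) := by
    refine interior_maximal (Set.image_mono ?_) (isOpen_image_polarMap_openBox ha hb)
    rintro ⟨u, r, φ⟩ ⟨hu, hr, hφ⟩
    exact ⟨⟨hu.1, hu.2.le⟩, ⟨hr.1, hr.2.le⟩, ⟨hφ.1, hφ.2.le⟩⟩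
  intro w hw
  have hw1 : w ∈ closure (sectorIoc a b) := hw.1
  have hw2 : w ∉ interior (sectorIoc a b) := hw.2
  obtain ⟨p, hp, rfl⟩ := hcl hw1
  exact ⟨p, ⟨hp, fun hpt ↦ hw2 (hint ⟨p, hpt, rfl⟩)⟩, rfl⟩

/-- `sectorIoc` is bounded. [folklore] -/
theorem isBounded_sectorIoc (a b : ℝ × ℝ) : Bornology.IsBounded (sectorIoc a b) :=
  (isBounded_sector a b).subset (sectorIoc_subset_sector a b)

/-- **Uniform cover of the frontier of the scaled, translated half-open cells.**
[cite: Marcus2018, Ch. 6, proof of Lemma 2] -/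
theorem exists_cover_frontier_sectorIoc :
    ∃ C : ℝ, 0 ≤ C ∧ ∀ a b : ℝ × ℝ, ((0 : ℝ), -Real.pi) ≤ a → a ≤ b → b ≤ ((1 : ℝ), Real.pi) →
      ∀ t : ℝ, 1 ≤ t → ∀ c : ℝ × ℂ, ∃ Y : Finset (ℝ × ℂ), (Y.card : ℝ) ≤ C * t ^ 2 ∧
        frontier ((fun w ↦ t • w + c) '' sectorIoc a b) ⊆ ⋃ y ∈ Y, Metric.closedBall y 1 := by
  classical
  obtain ⟨K, hK⟩ := exists_lipschitzOnWith_polarMap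
  set D₀ : ℝ≥0 := 1 + 1 + ‖(2 * Real.pi : ℝ)‖₊ with hD₀
  refine ⟨6 * ((K : ℝ) * D₀ + 3) ^ 2, by positivity, fun a b ha hab hb t ht c ↦ ?_⟩
  have ht0 : 0 ≤ t := by linarith
  have htne : t ≠ 0 := by linarith
  have hD : 1 + ‖b.1 - a.1‖₊ + ‖b.2 - a.2‖₊ ≤ D₀ := by
    rw [Prod.le_def] at ha hab hb
    have h1 : ‖b.1 - a.1‖₊ ≤ 1 := by
      rw [← NNReal.coe_le_coe, coe_nnnorm, Real.norm_eq_abs, NNReal.coe_one, abs_le]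
      simp only at ha hb hab
      constructor <;> linarith [ha.1, hb.1, hab.1]
    have h2 : ‖b.2 - a.2‖₊ ≤ ‖(2 * Real.pi : ℝ)‖₊ := by
      rw [← NNReal.coe_le_coe, coe_nnnorm, coe_nnnorm, Real.norm_eq_abs, Real.norm_eq_abs,
        abs_of_pos (by positivity : 0 < 2 * Real.pi), abs_le]
      simp only at ha hb hab
      constructor <;> linarith [ha.2, hb.2, hab.2]
    rw [hD₀]; gcongr
  have hpiece : ∀ k : Fin 6, LipschitzOnWith (t.toNNReal * (K * D₀))
      (fun q ↦ t • polarMap (faceMap a b k q)) (Set.Icc (0 : Fin 2 → ℝ) 1) := by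
    intro k
    have hf : LipschitzOnWith D₀ (faceMap a b k) (Set.Icc (0 : Fin 2 → ℝ) 1) :=
      ((lipschitzWith_faceMap a b k).weaken hD).lipschitzOnWith
    have hcomp : LipschitzOnWith (K * D₀) (polarMap ∘ faceMap a b k) (Set.Icc (0 : Fin 2 → ℝ) 1) :=
      hK.comp hf fun q hq ↦ faceMap_mem_bigBox ha hab hb k hq
    exact Literature.Algebra.EuclideanLattices.lipschitzOnWith_smul hcomp ht0
  have hcov : ∀ k : Fin 6, ∃ Y : Finset (ℝ × ℂ), (Y.card : ℝ) ≤ ((K : ℝ) * D₀ + 3) ^ 2 * t ^ 2 ∧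
      (fun q ↦ t • polarMap (faceMap a b k q)) '' Set.Icc (0 : Fin 2 → ℝ) 1 ⊆
        ⋃ y ∈ Y, Metric.closedBall y 1 := by
    intro k
    obtain ⟨Y, hY, hYcov⟩ := Literature.Algebra.EuclideanLattices.exists_cover_image_cube (hpiece k)
    refine ⟨Y, hY.trans ?_, hYcov⟩
    rw [NNReal.coe_mul, Real.coe_toNNReal _ ht0, NNReal.coe_mul]
    have hKD : 0 ≤ (K : ℝ) * D₀ := by positivity
    calc (t * ((K : ℝ) * D₀) + 3) ^ 2 ≤ (t * ((K : ℝ) * D₀) + 3 * t) ^ 2 := by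
          gcongr; linarith
      _ = ((K : ℝ) * D₀ + 3) ^ 2 * t ^ 2 := by ring
  choose Y hY hYcov using hcov
  refine ⟨Finset.univ.biUnion fun k ↦ (Y k).image (· + c), ?_, ?_⟩
  · calc ((Finset.univ.biUnion fun k ↦ (Y k).image (· + c)).card : ℝ)
        ≤ ∑ k, (((Y k).image (· + c)).card : ℝ) := by exact_mod_cast Finset.card_biUnion_le
      _ ≤ ∑ k : Fin 6, ((K : ℝ) * D₀ + 3) ^ 2 * t ^ 2 := Finset.sum_le_sum fun k _ ↦ by
          have h1 : (((Y k).image (· + c)).card : ℝ) ≤ (Y k).card := by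
            exact_mod_cast Finset.card_image_le
          exact h1.trans (hY k)
      _ = 6 * ((K : ℝ) * D₀ + 3) ^ 2 * t ^ 2 := by
          rw [Finset.sum_const, Finset.card_univ, Fintype.card_fin, nsmul_eq_mul]; push_cast; ring
  · have himg : (fun w ↦ t • w + c) '' sectorIoc a b = (Homeomorph.addRight c) '' (t • sectorIoc a b) := by
      rw [← Set.image_smul, Set.image_image]; rfl
    rw [himg, ← Homeomorph.image_frontier, Literature.Algebra.EuclideanLattices.frontier_smul htne]
    rintro w ⟨z, hz, rfl⟩
    obtain ⟨x, hx, rfl⟩ := Set.mem_smul_set.1 hz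
    rw [Prod.le_def] at ha hb
    have hfr := frontier_sectorIoc_subset (a := a) (b := b) (by simpa using ha.2) (by simpa using hb.2) hx
    obtain ⟨p, hp, rfl⟩ := hfr
    obtain ⟨k, hk⟩ := Set.mem_iUnion.1 (diff_subset_iUnion_faceMap hab hp)
    obtain ⟨q, hq, rfl⟩ := hk
    have hmem := hYcov k ⟨q, hq, rfl⟩
    simp only [Set.mem_iUnion, Metric.mem_closedBall, exists_prop] at hmem ⊢
    obtain ⟨y, hy, hdist⟩ := hmem
    refine ⟨y + c, Finset.mem_biUnion.2 ⟨k, Finset.mem_univ _, Finset.mem_image.2 ⟨y, hy, rfl⟩⟩, ?_⟩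
    simpa [Homeomorph.addRight, dist_eq_norm] using hdist

/-- **Uniform lattice-point count in the scaled, translated half-open cells**: one `C` with
`|#(𝓞_K-points in t·sectorIoc a b + c) − vol(sector a b) t³/covol| ≤ C t²` for all boxes
`(0,−π) ≤ a ≤ b ≤ (1,π)`, `t ≥ 1`, `c`. [cite: Marcus2018, Ch. 6, Lemma 2] -/
theorem exists_uniform_sectorIoc_count :
    ∃ C : ℝ, ∀ a b : ℝ × ℝ, ((0 : ℝ), -Real.pi) ≤ a → a ≤ b → b ≤ ((1 : ℝ), Real.pi) →
      ∀ t : ℝ, 1 ≤ t → ∀ c : ℝ × ℂ,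
        |(Nat.card (((fun w ↦ t • w + c) '' sectorIoc a b) ∩
              (span ℤ (Set.range basisW) : Set (ℝ × ℂ)) : Set (ℝ × ℂ)) : ℝ) -
            volume.real (sector a b) / volume.real (ZSpan.fundamentalDomain basisW) * t ^ 3| ≤
          C * t ^ 2 := by
  obtain ⟨C₀, hC₀, hcov⟩ := exists_cover_frontier_sectorIoc
  set M : ℝ := volume.real (Metric.closedBall (0 : ℝ × ℂ)
      (1 + 2 * Literature.Algebra.EuclideanLattices.cellRadius basisW)) /
    volume.real (ZSpan.fundamentalDomain basisW) with hM
  have hM0 : 0 ≤ M := div_nonneg measureReal_nonneg measureReal_nonneg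
  refine ⟨C₀ * M, fun a b ha hab hb t ht c ↦ ?_⟩
  have ht0 : 0 ≤ t := by linarith
  obtain ⟨Y, hYcard, hYcov⟩ := hcov a b ha hab hb t ht c
  have hbdd : Bornology.IsBounded ((fun w ↦ t • w + c) '' sectorIoc a b) := by
    obtain ⟨R, hR⟩ := (isBounded_sectorIoc a b).subset_closedBall 0
    refine (Metric.isBounded_closedBall (x := c) (r := t * R)).subset ?_
    rintro _ ⟨w, hw, rfl⟩
    have hwR : ‖w‖ ≤ R := by simpa using hR hw
    rw [Metric.mem_closedBall, dist_eq_norm, add_sub_cancel_right, norm_smul, Real.norm_of_nonneg ht0]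
    exact mul_le_mul_of_nonneg_left hwR ht0
  have h := Literature.Algebra.EuclideanLattices.abs_card_sub_div_le_of_cover basisW volume hbdd hYcov
  have hvol : volume.real ((fun w ↦ t • w + c) '' sectorIoc a b) = t ^ 3 * volume.real (sector a b) := by
    rw [measureReal_def, volume_image_smul_add ht0, ENNReal.toReal_mul,
      ENNReal.toReal_ofReal (by positivity), volume_sectorIoc, measureReal_def]
  rw [hvol] at h
  have e : volume.real (sector a b) / volume.real (ZSpan.fundamentalDomain basisW) * t ^ 3 =
      t ^ 3 * volume.real (sector a b) / volume.real (ZSpan.fundamentalDomain basisW) := by ring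
  rw [e]
  calc _ ≤ Y.card * M := h
    _ ≤ C₀ * t ^ 2 * M := by gcongr
    _ = C₀ * M * t ^ 2 := by ring

/-- **Membership in a half-open cell through the coordinates** (angles in `[−π, π]`):
`w ∈ sectorIoc a b` iff `w₁ > 0`, `w₂ ≠ 0`, `N(w) ≤ 1`, `r(w) ∈ (a₁, b₁]`, `arg w₂ ∈ (a₂, b₂]`.
[folklore] -/
theorem mem_sectorIoc_iff {a b : ℝ × ℝ} (ha : -Real.pi ≤ a.2) (hb : b.2 ≤ Real.pi) {w : ℝ × ℂ} :
    w ∈ sectorIoc a b ↔ 0 < w.1 ∧ w.2 ≠ 0 ∧ wNorm w ≤ 1 ∧ wR w ∈ Set.Ioc a.1 b.1 ∧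
      Complex.arg w.2 ∈ Set.Ioc a.2 b.2 := by
  constructor
  · rintro ⟨p, ⟨hu, hr, hφ0⟩, rfl⟩
    have hφ : p.2.2 ∈ Set.Ioc (-Real.pi) Real.pi := ⟨ha.trans_lt hφ0.1, hφ0.2.trans hb⟩
    refine ⟨polarMap_fst_pos hu.1, polarMap_snd_ne_zero hu.1, ?_, ?_, ?_⟩
    · rw [wNorm_polarMap]; exact pow_le_one₀ hu.1.le hu.2
    · rw [wR_polarMap hu.1]; exact hr
    · rw [arg_polarMap_snd hu.1 hφ]; exact hφ0
  · rintro ⟨h1, h2, hN, hr, hφ⟩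
    refine ⟨(wU w, wR w, Complex.arg w.2), ⟨⟨wU_pos h1 h2, ?_⟩, hr, hφ⟩, polarMap_wCoord h1 h2⟩
    have h3 := wU_pow_three h1 h2
    by_contra hcon
    rw [not_le] at hcon
    have : 1 < wU w ^ 3 := by
      calc (1 : ℝ) = 1 ^ 3 := by norm_num
        _ < wU w ^ 3 := by gcongr
    linarith

/-! ## The characters, scaling, geometric sums -/

/-- **The torus characters** `ψ_{j,κ}(w) = e^{ij·arg w₂} · e(−κ·r(w))` on `W` (Heath-Brown's
`ν₁^j ν₂^k` up to the norm twist `N^{-iT}` and the unit normalisations, (9.2)). [cite: HeathBrownActa2001, §9 (9.2)] -/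
def charW (j : ℤ) (κ : ℝ) (w : ℝ × ℂ) : ℂ :=
  Complex.exp ((((j : ℝ) * Complex.arg w.2 : ℝ) : ℂ) * I) *
    Complex.exp (((-(2 * Real.pi * κ * wR w) : ℝ) : ℂ) * I)

/-- The reference value `e^{ijφ₀} e(−κr₀)` of the character at a corner of a cell. [folklore] -/
def charRef (j : ℤ) (κ r₀ φ₀ : ℝ) : ℂ :=
  Complex.exp ((((j : ℝ) * φ₀ : ℝ) : ℂ) * I) * Complex.exp (((-(2 * Real.pi * κ * r₀) : ℝ) : ℂ) * I)

/-- `|ψ(w)| = 1`. [folklore] -/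
theorem norm_charW (j : ℤ) (κ : ℝ) (w : ℝ × ℂ) : ‖charW j κ w‖ = 1 := by
  rw [charW, norm_mul, Complex.norm_exp_ofReal_mul_I, Complex.norm_exp_ofReal_mul_I, mul_one]

/-- `|charRef| = 1`. [folklore] -/
theorem norm_charRef (j : ℤ) (κ r₀ φ₀ : ℝ) : ‖charRef j κ r₀ φ₀‖ = 1 := by
  rw [charRef, norm_mul, Complex.norm_exp_ofReal_mul_I, Complex.norm_exp_ofReal_mul_I, mul_one]

/-- `‖e^{ix} − e^{iy}‖ ≤ |x − y|`. [folklore] -/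
theorem norm_exp_mul_I_sub_le (x y : ℝ) :
    ‖Complex.exp ((x : ℂ) * I) - Complex.exp ((y : ℂ) * I)‖ ≤ |x - y| := by
  have h : Complex.exp ((x : ℂ) * I) - Complex.exp ((y : ℂ) * I) =
      Complex.exp ((y : ℂ) * I) * (Complex.exp (I * ((x - y : ℝ) : ℂ)) - 1) := by
    rw [mul_sub, mul_one, ← Complex.exp_add]
    congr 1; push_cast; ring
  rw [h, norm_mul, Complex.norm_exp_ofReal_mul_I, one_mul]
  have := Real.norm_exp_I_mul_ofReal_sub_one_le (x := x - y)
  rwa [Real.norm_eq_abs] at this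

/-- `‖ab − a'b'‖ ≤ ‖a − a'‖ + ‖b − b'‖` for `‖a‖ ≤ 1`, `‖b'‖ ≤ 1`. [folklore] -/
theorem norm_mul_sub_mul_le {a b a' b' : ℂ} (ha : ‖a‖ ≤ 1) (hb' : ‖b'‖ ≤ 1) :
    ‖a * b - a' * b'‖ ≤ ‖a - a'‖ + ‖b - b'‖ := by
  have h : a * b - a' * b' = a * (b - b') + (a - a') * b' := by ring
  rw [h]
  calc ‖a * (b - b') + (a - a') * b'‖ ≤ ‖a * (b - b')‖ + ‖(a - a') * b'‖ := norm_add_le _ _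
    _ = ‖a‖ * ‖b - b'‖ + ‖a - a'‖ * ‖b'‖ := by rw [norm_mul, norm_mul]
    _ ≤ 1 * ‖b - b'‖ + ‖a - a'‖ * 1 := by gcongr
    _ = ‖a - a'‖ + ‖b - b'‖ := by ring

/-- **Variation of the character inside a cell**: if `r(w) ∈ (r₀ − δ', r₀]` and
`arg w₂ ∈ (φ₀ − δ, φ₀]` then `‖ψ(w) − ψ_ref‖ ≤ |j|δ + 2π|κ|δ'`. [folklore] -/
theorem norm_charW_sub_charRef_le {j : ℤ} {κ : ℝ} {w : ℝ × ℂ} {r₀ φ₀ δ δ' : ℝ}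
    (hr : wR w ∈ Set.Ioc (r₀ - δ') r₀) (hφ : Complex.arg w.2 ∈ Set.Ioc (φ₀ - δ) φ₀) :
    ‖charW j κ w - charRef j κ r₀ φ₀‖ ≤ |(j : ℝ)| * δ + 2 * Real.pi * |κ| * δ' := by
  rw [charW, charRef]
  refine (norm_mul_sub_mul_le (le_of_eq (Complex.norm_exp_ofReal_mul_I _))
    (le_of_eq (Complex.norm_exp_ofReal_mul_I _))).trans ?_
  refine add_le_add ((norm_exp_mul_I_sub_le _ _).trans ?_) ((norm_exp_mul_I_sub_le _ _).trans ?_)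
  · rw [← mul_sub, abs_mul]
    refine mul_le_mul_of_nonneg_left ?_ (abs_nonneg _)
    rw [abs_le]; constructor <;> linarith [hφ.1, hφ.2]
  · have : -(2 * Real.pi * κ * wR w) - -(2 * Real.pi * κ * r₀) = 2 * Real.pi * κ * (r₀ - wR w) := by ring
    rw [this, abs_mul, abs_mul, abs_of_pos Real.two_pi_pos]
    refine mul_le_mul_of_nonneg_left ?_ (by positivity)
    rw [abs_le]; constructor <;> linarith [hr.1, hr.2]

/-! ### Scaling invariance of the coordinates -/

/-- `N(τw) = τ³ N(w)`. [folklore] -/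
theorem wNorm_smul (τ : ℝ) (w : ℝ × ℂ) : wNorm (τ • w) = τ ^ 3 * wNorm w := by
  rw [wNorm, wNorm, Prod.smul_fst, Prod.smul_snd, Complex.real_smul, Complex.normSq_mul,
    Complex.normSq_ofReal, smul_eq_mul]
  ring

/-- `u(τw) = τ u(w)` for `τ ≥ 0` (and `N(w) ≥ 0`). [folklore] -/
theorem wU_smul {τ : ℝ} (hτ : 0 ≤ τ) {w : ℝ × ℂ} (hw : 0 ≤ wNorm w) : wU (τ • w) = τ * wU w := by
  rw [wU, wU, wNorm_smul, Real.mul_rpow (pow_nonneg hτ 3) hw, ← Real.rpow_natCast,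
    ← Real.rpow_mul hτ]
  norm_num

/-- `r(τw) = r(w)` for `τ > 0`, `w₁ > 0`, `w₂ ≠ 0`. [folklore] -/
theorem wR_smul {τ : ℝ} (hτ : 0 < τ) {w : ℝ × ℂ} (h1 : 0 < w.1) (h2 : w.2 ≠ 0) : wR (τ • w) = wR w := by
  rw [wR, wR, wU_smul hτ.le (wNorm_pos h1 h2).le, Prod.smul_fst, smul_eq_mul,
    mul_div_mul_left _ _ hτ.ne']

/-- `arg (τw)₂ = arg w₂` for `τ > 0`. [folklore] -/
theorem arg_smul_snd {τ : ℝ} (hτ : 0 < τ) (w : ℝ × ℂ) : Complex.arg (τ • w).2 = Complex.arg w.2 := by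
  rw [Prod.smul_snd, Complex.real_smul, Complex.arg_real_mul _ hτ]

/-- **The character is scale invariant**: `ψ(τw) = ψ(w)` for `τ > 0`, `w₁ > 0`, `w₂ ≠ 0`. [folklore] -/
theorem charW_smul {τ : ℝ} (hτ : 0 < τ) {w : ℝ × ℂ} (h1 : 0 < w.1) (h2 : w.2 ≠ 0) (j : ℤ) (κ : ℝ) :
    charW j κ (τ • w) = charW j κ w := by
  rw [charW, charW, arg_smul_snd hτ, wR_smul hτ h1 h2]

/-- The fundamental region is stable under shrinking: `τ • F ⊆ F` for `0 < τ ≤ 1`,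
`F = sectorIoc (0,−π) (1,π)`. [folklore] -/
theorem smul_fundRegion_subset {τ : ℝ} (hτ : 0 < τ) (hτ1 : τ ≤ 1) :
    τ • sectorIoc ((0 : ℝ), -Real.pi) (1, Real.pi) ⊆ sectorIoc ((0 : ℝ), -Real.pi) (1, Real.pi) := by
  intro w hw
  obtain ⟨w', hw', rfl⟩ := Set.mem_smul_set.1 hw
  rw [mem_sectorIoc_iff le_rfl le_rfl] at hw' ⊢
  obtain ⟨h1, h2, hN, hr, hφ⟩ := hw'
  refine ⟨by simpa using mul_pos hτ h1, ?_, ?_, ?_, ?_⟩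
  · simpa [Complex.real_smul] using mul_ne_zero (Complex.ofReal_ne_zero.2 hτ.ne') h2
  · rw [wNorm_smul]
    calc τ ^ 3 * wNorm w' ≤ 1 * 1 :=
          mul_le_mul (pow_le_one₀ hτ.le hτ1) hN (wNorm_pos h1 h2).le zero_le_one
      _ = 1 := one_mul _
  · rwa [wR_smul hτ h1 h2]
  · rwa [arg_smul_snd hτ]

/-! ### Vanishing of the discrete character sums over a full period -/

/-- **A twisted sum over a full period vanishes**: for `m ∈ ℤ`, `0 < |m| < M` and `cM = 2π`,
`∑_{i<M} e^{im(θ₀ + c(i+1))} = 0` (geometric sum with ratio `ζ = e^{imc}`, `ζ^M = e^{2πim} = 1`,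
`ζ ≠ 1` since `M ∤ m`). [folklore] -/
theorem sum_range_exp_eq_zero {M : ℕ} {m : ℤ} (hm : m ≠ 0) (hmM : m.natAbs < M) (θ₀ : ℝ) {c : ℝ}
    (hc : c * M = 2 * Real.pi) :
    ∑ i ∈ Finset.range M, Complex.exp ((((m : ℝ) * (θ₀ + c * (i + 1)) : ℝ) : ℂ) * I) = 0 := by
  have hM0 : 0 < M := by omega
  have hMne : (M : ℝ) ≠ 0 := by positivity
  set ζ : ℂ := Complex.exp ((((m : ℝ) * c : ℝ) : ℂ) * I) with hζ
  -- the terms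
  have hterm : ∀ i : ℕ, Complex.exp ((((m : ℝ) * (θ₀ + c * (i + 1)) : ℝ) : ℂ) * I) =
      Complex.exp ((((m : ℝ) * θ₀ : ℝ) : ℂ) * I) * ζ * ζ ^ i := by
    intro i
    rw [hζ, ← Complex.exp_nat_mul, ← Complex.exp_add, ← Complex.exp_add]
    congr 1; push_cast; ring
  simp_rw [hterm, ← Finset.mul_sum]
  -- `ζ^M = 1`
  have hζM : ζ ^ M = 1 := by
    rw [hζ, ← Complex.exp_nat_mul]
    have : (M : ℂ) * ((((m : ℝ) * c : ℝ) : ℂ) * I) = (m : ℂ) * (2 * Real.pi * I) := by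
      have hc' : (c : ℂ) * M = 2 * Real.pi := by exact_mod_cast hc
      push_cast
      linear_combination (m : ℂ) * I * hc'
    rw [this]
    exact Complex.exp_int_mul_two_pi_mul_I m
  -- `ζ ≠ 1`
  have hζ1 : ζ ≠ 1 := by
    intro h1
    rw [hζ, Complex.exp_eq_one_iff] at h1
    obtain ⟨n, hn⟩ := h1
    have hreal : (m : ℝ) * c = n * (2 * Real.pi) := by
      have := congrArg Complex.im hn
      simp at this
      linarith
    have hc2 : c = 2 * Real.pi / M := by field_simp; linarith
    rw [hc2] at hreal
    have hmn : (m : ℝ) = n * M := by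
      field_simp at hreal
      nlinarith [Real.pi_pos]
    have hmn' : m = n * M := by exact_mod_cast hmn
    have : (M : ℤ) ∣ m := ⟨n, by rw [hmn']; ring⟩
    have hle := Int.le_of_dvd (by positivity : 0 < |m|) ((dvd_abs _ _).2 this)
    have : (m.natAbs : ℤ) = |m| := Int.natCast_natAbs m
    omega
  rw [geom_sum_eq hζ1, hζM, sub_self, zero_div, mul_zero]

/-! ## Congruence classes and cells -/

/-- `v ≡ a (mod q)` coordinatewise on `ℤ³`. [folklore] -/
def CongMod (q : ℕ) (a v : ℤ × ℤ × ℤ) : Prop :=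
  (q : ℤ) ∣ v.1 - a.1 ∧ (q : ℤ) ∣ v.2.1 - a.2.1 ∧ (q : ℤ) ∣ v.2.2 - a.2.2

/-- `castVec` is additive. [folklore] -/
theorem castVec_add' (u v : ℤ × ℤ × ℤ) : castVec (u + v) = castVec u + castVec v := by
  refine Prod.ext ?_ (Prod.ext ?_ ?_) <;> simp [castVec]

/-- `castVec (q • u) = q • castVec u`. [folklore] -/
theorem castVec_zsmul' (q : ℤ) (u : ℤ × ℤ × ℤ) : castVec (q • u) = (q : ℝ) • castVec u := by
  refine Prod.ext ?_ (Prod.ext ?_ ?_) <;> simp [castVec]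

/-- **The congruence class `a + qℤ³` meets `t·X` in as many points as `ℤ³` meets `(t/q)·X − q⁻¹·â`**
(the substitution `v = a + qu`). [folklore] -/
def congEquiv (q : ℕ) (hq : 0 < q) (a : ℤ × ℤ × ℤ) (t : ℝ) (X : Set (ℝ × ℂ)) :
    {v : ℤ × ℤ × ℤ // CongMod q a v ∧ embW (castVec v) ∈ t • X} ≃
      {u : ℤ × ℤ × ℤ // embW (castVec u) ∈
        (fun w : ℝ × ℂ ↦ (t / q) • w + (-(1 / (q : ℝ))) • embW (castVec a)) '' X} where
  toFun v := ⟨((v.1.1 - a.1) / q, (v.1.2.1 - a.2.1) / q, (v.1.2.2 - a.2.2) / q), by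
    obtain ⟨⟨h1, h2, h3⟩, hmem⟩ := v.2
    obtain ⟨x, hx, hxe⟩ := Set.mem_smul_set.1 hmem
    refine ⟨x, hx, ?_⟩
    have hq0 : (q : ℝ) ≠ 0 := by positivity
    have hv : v.1 = a + (q : ℤ) • ((v.1.1 - a.1) / q, (v.1.2.1 - a.2.1) / q, (v.1.2.2 - a.2.2) / q) := by
      refine Prod.ext ?_ (Prod.ext ?_ ?_)
      · simp only [Prod.fst_add, Prod.smul_fst, smul_eq_mul]; rw [Int.mul_ediv_cancel' h1]; ring
      · simp only [Prod.snd_add, Prod.fst_add, Prod.smul_snd, Prod.smul_fst, smul_eq_mul]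
        rw [Int.mul_ediv_cancel' h2]; ring
      · simp only [Prod.snd_add, Prod.smul_snd, smul_eq_mul]; rw [Int.mul_ediv_cancel' h3]; ring
    have he : embW (castVec v.1) = embW (castVec a) +
        (q : ℝ) • embW (castVec ((v.1.1 - a.1) / q, (v.1.2.1 - a.2.1) / q, (v.1.2.2 - a.2.2) / q)) := by
      conv_lhs => rw [hv]
      rw [castVec_add', castVec_zsmul', map_add, map_smul, Int.cast_natCast]
    rw [he] at hxe
    -- solve for `embW û`
    have : (q : ℝ) • embW (castVec ((v.1.1 - a.1) / q, (v.1.2.1 - a.2.1) / q, (v.1.2.2 - a.2.2) / q)) =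
        t • x - embW (castVec a) := by rw [hxe]; abel
    calc (t / q) • x + (-(1 / (q : ℝ))) • embW (castVec a)
        = (1 / (q : ℝ)) • (t • x - embW (castVec a)) := by
          rw [smul_sub, smul_smul, neg_smul, ← sub_eq_add_neg, div_eq_mul_inv, one_div, mul_comm]
      _ = _ := by rw [← this, smul_smul, one_div, inv_mul_cancel₀ hq0, one_smul]⟩
  invFun u := ⟨a + (q : ℤ) • u.1, by
    obtain ⟨x, hx, hxe⟩ := u.2
    refine ⟨⟨?_, ?_, ?_⟩, ?_⟩
    · simp
    · simp
    · simp
    · rw [castVec_add', castVec_zsmul', map_add, map_smul, ← hxe]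
      refine Set.mem_smul_set.2 ⟨x, hx, ?_⟩
      have hq0 : (q : ℝ) ≠ 0 := by positivity
      simp only [smul_add, smul_smul, Int.cast_natCast]
      rw [mul_div_cancel₀ _ hq0, show (q : ℝ) * -(1 / (q : ℝ)) = -1 by field_simp, neg_one_smul]
      abel⟩
  left_inv v := by
    obtain ⟨v, ⟨h1, h2, h3⟩, hmem⟩ := v
    simp only [Subtype.mk.injEq]
    refine Prod.ext ?_ (Prod.ext ?_ ?_)
    · simp only [Prod.fst_add, Prod.smul_fst, smul_eq_mul]; rw [Int.mul_ediv_cancel' h1]; ring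
    · simp only [Prod.snd_add, Prod.fst_add, Prod.smul_snd, Prod.smul_fst, smul_eq_mul]
      rw [Int.mul_ediv_cancel' h2]; ring
    · simp only [Prod.snd_add, Prod.smul_snd, smul_eq_mul]; rw [Int.mul_ediv_cancel' h3]; ring
  right_inv u := by
    obtain ⟨u, hu⟩ := u
    have hq0 : (q : ℤ) ≠ 0 := by positivity
    simp only [Subtype.mk.injEq]
    refine Prod.ext ?_ (Prod.ext ?_ ?_) <;> simp [Int.mul_ediv_cancel_left _ hq0]

/-- **Counting a congruence class in `t·X` = counting lattice points in `(t/q)·X + c`.** [folklore] -/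
theorem card_cong_eq (q : ℕ) (hq : 0 < q) (a : ℤ × ℤ × ℤ) (t : ℝ) (X : Set (ℝ × ℂ)) :
    Nat.card {v : ℤ × ℤ × ℤ // CongMod q a v ∧ embW (castVec v) ∈ t • X} =
      Nat.card ↥(((fun w : ℝ × ℂ ↦ (t / q) • w + (-(1 / (q : ℝ))) • embW (castVec a)) '' X) ∩
        (span ℤ (Set.range basisW) : Set (ℝ × ℂ))) := by
  rw [Nat.card_congr (congEquiv q hq a t X), ncard_preimage_eq_card_inter]

/-! ### The cells of the grid -/

/-- Lower corner of the cell `(i, l)`: `(l/M, −π + 2πi/M)`. [folklore] -/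
def cellLo (M i l : ℕ) : ℝ × ℝ := ((l : ℝ) / M, -Real.pi + 2 * Real.pi * i / M)

/-- Upper corner of the cell `(i, l)`: `((l+1)/M, −π + 2π(i+1)/M)`. [folklore] -/
def cellHi (M i l : ℕ) : ℝ × ℝ := (((l : ℝ) + 1) / M, -Real.pi + 2 * Real.pi * (i + 1) / M)

/-- The cells are translates of the cell `(0,0)`. [folklore] -/
theorem cellLo_eq_add (M i l : ℕ) : cellLo M i l = cellLo M 0 0 + ((l : ℝ) / M, 2 * Real.pi * i / M) := by
  refine Prod.ext ?_ ?_ <;> simp [cellLo]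

/-- The cells are translates of the cell `(0,0)`. [folklore] -/
theorem cellHi_eq_add (M i l : ℕ) : cellHi M i l = cellHi M 0 0 + ((l : ℝ) / M, 2 * Real.pi * i / M) := by
  refine Prod.ext ?_ ?_ <;> simp [cellHi] <;> ring

/-- **All cells have the same volume.** [folklore] -/
theorem volume_sector_cell (M i l : ℕ) :
    volume (sector (cellLo M i l) (cellHi M i l)) = volume (sector (cellLo M 0 0) (cellHi M 0 0)) := by
  rw [cellLo_eq_add M i l, cellHi_eq_add M i l, volume_sector_add]

/-- The cells lie within the admissible range `(0,−π) ≤ lo ≤ hi ≤ (1,π)` (`i, l < M`). [folklore] -/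
theorem cell_bounds {M i l : ℕ} (hi : i < M) (hl : l < M) :
    ((0 : ℝ), -Real.pi) ≤ cellLo M i l ∧ cellLo M i l ≤ cellHi M i l ∧ cellHi M i l ≤ ((1 : ℝ), Real.pi) := by
  have hM : (0 : ℝ) < M := by exact_mod_cast (Nat.zero_le i).trans_lt hi
  have hi' : (i : ℝ) + 1 ≤ M := by exact_mod_cast hi
  have hl' : (l : ℝ) + 1 ≤ M := by exact_mod_cast hl
  simp only [cellLo, cellHi, Prod.le_def]
  refine ⟨⟨by positivity, ?_⟩, ⟨?_, ?_⟩, ⟨?_, ?_⟩⟩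
  · have : 0 ≤ 2 * Real.pi * i / M := by positivity
    linarith
  · gcongr; linarith
  · gcongr; linarith
  · rw [div_le_one hM]; exact hl'
  · have : 2 * Real.pi * (i + 1) / M ≤ 2 * Real.pi := by
      rw [div_le_iff₀ hM]; nlinarith [Real.pi_pos]
    linarith

/-- The cell index of a point: `(⌈(arg w₂ + π)M/2π⌉ − 1, ⌈r(w)M⌉ − 1)`. [folklore] -/
def cellIdx (M : ℕ) (w : ℝ × ℂ) : ℕ × ℕ :=
  (⌈(Complex.arg w.2 + Real.pi) * M / (2 * Real.pi)⌉₊ - 1, ⌈wR w * M⌉₊ - 1)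

/-- `x ∈ (0, 1]` and `M ≥ 1` give `⌈xM⌉ − 1 < M` and `x ∈ ((⌈xM⌉−1)/M, ⌈xM⌉/M]`; conversely the index
is determined by the cell. [folklore] -/
theorem ceil_cell {x : ℝ} {M : ℕ} (hM : 0 < M) (hx : x ∈ Set.Ioc (0 : ℝ) 1) (n : ℕ) :
    ⌈x * M⌉₊ - 1 = n ↔ x ∈ Set.Ioc ((n : ℝ) / M) (((n : ℝ) + 1) / M) := by
  have hMr : (0 : ℝ) < M := by exact_mod_cast hM
  have hxM : 0 < x * M := mul_pos hx.1 hMr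
  have h1 : 1 ≤ ⌈x * M⌉₊ := Nat.one_le_iff_ne_zero.2 (by rw [Ne, Nat.ceil_eq_zero]; linarith)
  rw [Set.mem_Ioc, div_lt_iff₀ hMr, le_div_iff₀ hMr]
  constructor
  · intro h
    have hc : ⌈x * M⌉₊ = n + 1 := by omega
    constructor
    · have := (Nat.lt_ceil (n := n) (a := x * M)).1 (by omega)
      exact this
    · have := (Nat.ceil_le (a := x * M) (n := n + 1)).1 hc.le
      exact_mod_cast this
  · rintro ⟨hlo, hhi⟩
    have h2 : n < ⌈x * M⌉₊ := Nat.lt_ceil.2 hlo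
    have h3 : ⌈x * M⌉₊ ≤ n + 1 := Nat.ceil_le.2 (by exact_mod_cast hhi)
    omega

/-- **Cell membership through the index**: for `w` in the fundamental region
`F = sectorIoc (0,−π) (1,π)` and `i, l`, `w ∈ sectorIoc (cellLo M i l) (cellHi M i l)` iff
`cellIdx M w = (i, l)` (`M ≥ 1`, `i, l < M`). [folklore] -/
theorem mem_cell_iff_cellIdx {M : ℕ} (hM : 0 < M) {i l : ℕ} (hi : i < M) (hl : l < M) {w : ℝ × ℂ}
    (hw : w ∈ sectorIoc ((0 : ℝ), -Real.pi) (1, Real.pi)) :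
    w ∈ sectorIoc (cellLo M i l) (cellHi M i l) ↔ cellIdx M w = (i, l) := by
  have hb := cell_bounds hi hl
  have hMr : (0 : ℝ) < M := by exact_mod_cast hM
  rw [mem_sectorIoc_iff le_rfl le_rfl] at hw
  obtain ⟨h1, h2, hN, hr, hφ⟩ := hw
  rw [mem_sectorIoc_iff (by have := hb.1; rw [Prod.le_def] at this; simpa using this.2)
    (by have := hb.2.2; rw [Prod.le_def] at this; simpa using this.2), cellIdx, Prod.mk.injEq]
  simp only [h1, h2, hN, true_and, ne_eq, not_false_eq_true]
  -- the angular coordinate normalised to `(0,1]`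
  set y : ℝ := (Complex.arg w.2 + Real.pi) / (2 * Real.pi) with hy
  have hy01 : y ∈ Set.Ioc (0 : ℝ) 1 := by
    rw [hy, Set.mem_Ioc, lt_div_iff₀ Real.two_pi_pos, div_le_one Real.two_pi_pos]
    constructor <;> linarith [hφ.1, hφ.2]
  have hyM : (Complex.arg w.2 + Real.pi) * M / (2 * Real.pi) = y * M := by rw [hy]; ring
  rw [hyM, ceil_cell hM hy01 i, ceil_cell hM hr l]
  -- translate the angular cell
  have hang : Complex.arg w.2 ∈ Set.Ioc (cellLo M i l).2 (cellHi M i l).2 ↔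
      y ∈ Set.Ioc ((i : ℝ) / M) (((i : ℝ) + 1) / M) := by
    simp only [cellLo, cellHi, Set.mem_Ioc, hy]
    rw [lt_div_iff₀ Real.two_pi_pos, div_le_iff₀ Real.two_pi_pos]
    constructor
    · rintro ⟨ha, hb'⟩
      constructor
      · have : 2 * Real.pi * i / M = (i : ℝ) / M * (2 * Real.pi) := by ring
        linarith
      · have : 2 * Real.pi * (i + 1) / M = ((i : ℝ) + 1) / M * (2 * Real.pi) := by ring
        linarith
    · rintro ⟨ha, hb'⟩
      constructor
      · have : 2 * Real.pi * i / M = (i : ℝ) / M * (2 * Real.pi) := by ring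
        linarith
      · have : 2 * Real.pi * (i + 1) / M = ((i : ℝ) + 1) / M * (2 * Real.pi) := by ring
        linarith
  have hrad : wR w ∈ Set.Ioc (cellLo M i l).1 (cellHi M i l).1 ↔
      wR w ∈ Set.Ioc ((l : ℝ) / M) (((l : ℝ) + 1) / M) := by simp only [cellLo, cellHi]
  rw [hang, hrad]
  tauto

/-- The index of a point of the fundamental region lies in `range M × range M` (`M ≥ 1`). [folklore] -/
theorem cellIdx_mem {M : ℕ} (hM : 0 < M) {w : ℝ × ℂ}
    (hw : w ∈ sectorIoc ((0 : ℝ), -Real.pi) (1, Real.pi)) :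
    cellIdx M w ∈ Finset.range M ×ˢ Finset.range M := by
  rw [mem_sectorIoc_iff le_rfl le_rfl] at hw
  obtain ⟨h1, h2, hN, hr, hφ⟩ := hw
  have hMr : (0 : ℝ) < M := by exact_mod_cast hM
  rw [Finset.mem_product, Finset.mem_range, Finset.mem_range, cellIdx]
  simp only
  constructor
  · have hle : ⌈(Complex.arg w.2 + Real.pi) * M / (2 * Real.pi)⌉₊ ≤ M := by
      refine Nat.ceil_le.2 ?_
      rw [div_le_iff₀ Real.two_pi_pos]
      nlinarith [hφ.2, Real.pi_pos]
    have hpos : 1 ≤ ⌈(Complex.arg w.2 + Real.pi) * M / (2 * Real.pi)⌉₊ := by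
      refine Nat.one_le_iff_ne_zero.2 ?_
      rw [Ne, Nat.ceil_eq_zero, not_le]
      refine div_pos (mul_pos ?_ hMr) Real.two_pi_pos
      linarith [hφ.1]
    omega
  · have hle : ⌈wR w * M⌉₊ ≤ M := Nat.ceil_le.2 (by nlinarith [hr.2])
    have hpos : 1 ≤ ⌈wR w * M⌉₊ :=
      Nat.one_le_iff_ne_zero.2 (by rw [Ne, Nat.ceil_eq_zero, not_le]; exact mul_pos hr.1 hMr)
    omega

/-! ## Fibres and the main estimate -/

/-- The cell index is scale invariant (`τ > 0`, `w₁ > 0`, `w₂ ≠ 0`). [folklore] -/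
theorem cellIdx_smul {τ : ℝ} (hτ : 0 < τ) {w : ℝ × ℂ} (h1 : 0 < w.1) (h2 : w.2 ≠ 0) (M : ℕ) :
    cellIdx M (τ • w) = cellIdx M w := by
  rw [cellIdx, cellIdx, arg_smul_snd hτ, wR_smul hτ h1 h2]

/-- Points of `t • F` have `w₁ > 0` and `w₂ ≠ 0` (`t > 0`). [folklore] -/
theorem pos_of_mem_smul_fundRegion {t : ℝ} (ht : 0 < t) {w : ℝ × ℂ}
    (hw : w ∈ t • sectorIoc ((0 : ℝ), -Real.pi) (1, Real.pi)) : 0 < w.1 ∧ w.2 ≠ 0 := by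
  obtain ⟨w', hw', rfl⟩ := Set.mem_smul_set.1 hw
  rw [mem_sectorIoc_iff le_rfl le_rfl] at hw'
  refine ⟨by simpa using mul_pos ht hw'.1, ?_⟩
  simpa [Complex.real_smul] using mul_ne_zero (Complex.ofReal_ne_zero.2 ht.ne') hw'.2.1

/-- **The fibre of the cell index is the cell** (inside `T`): for `v ∈ T` (so `embW v̂ ∈ t•F`),
`cellIdx M (embW v̂) = (i,l)` iff `embW v̂ ∈ t • cell(i,l)`. [folklore] -/
theorem cellIdx_eq_iff_mem_smul_cell {t : ℝ} (ht : 0 < t) {M : ℕ} (hM : 0 < M) {i l : ℕ} (hi : i < M)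
    (hl : l < M) {w : ℝ × ℂ} (hw : w ∈ t • sectorIoc ((0 : ℝ), -Real.pi) (1, Real.pi)) :
    cellIdx M w = (i, l) ↔ w ∈ t • sectorIoc (cellLo M i l) (cellHi M i l) := by
  have hpos := pos_of_mem_smul_fundRegion ht hw
  rw [Set.mem_smul_set_iff_inv_smul_mem₀ ht.ne'] at hw ⊢
  rw [← cellIdx_smul (inv_pos.2 ht) hpos.1 hpos.2, mem_cell_iff_cellIdx hM hi hl hw]

/-- **Variation of `ψ` over the lattice points of one cell.** [folklore] -/
theorem norm_charW_sub_charRef_cell {t : ℝ} (ht : 0 < t) {M : ℕ} (hM : 0 < M) {i l : ℕ} (hi : i < M)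
    (hl : l < M) (j : ℤ) (κ : ℝ) {w : ℝ × ℂ} (hw : w ∈ t • sectorIoc (cellLo M i l) (cellHi M i l)) :
    ‖charW j κ w - charRef j κ (((l : ℝ) + 1) / M) (-Real.pi + 2 * Real.pi * (i + 1) / M)‖ ≤
      2 * Real.pi * (|(j : ℝ)| + |κ|) / M := by
  have hMr : (0 : ℝ) < M := by exact_mod_cast hM
  obtain ⟨w', hw', rfl⟩ := Set.mem_smul_set.1 hw
  have hb := cell_bounds hi hl
  rw [mem_sectorIoc_iff (by have := hb.1; rw [Prod.le_def] at this; simpa using this.2)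
    (by have := hb.2.2; rw [Prod.le_def] at this; simpa using this.2)] at hw'
  obtain ⟨h1, h2, -, hr, hφ⟩ := hw'
  rw [charW_smul ht h1 h2]
  simp only [cellLo, cellHi] at hr hφ
  have hr' : wR w' ∈ Set.Ioc (((l : ℝ) + 1) / M - 1 / M) (((l : ℝ) + 1) / M) := by
    have : ((l : ℝ) + 1) / M - 1 / M = (l : ℝ) / M := by ring
    rw [this]; exact hr
  have hφ' : Complex.arg w'.2 ∈ Set.Ioc (-Real.pi + 2 * Real.pi * (i + 1) / M - 2 * Real.pi / M)
      (-Real.pi + 2 * Real.pi * (i + 1) / M) := by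
    have : -Real.pi + 2 * Real.pi * (i + 1) / M - 2 * Real.pi / M = -Real.pi + 2 * Real.pi * i / M := by
      ring
    rw [this]; exact hφ
  refine (norm_charW_sub_charRef_le hr' hφ').trans (le_of_eq ?_)
  ring

/-- **The reference values sum to zero over the grid** when `0 < |j| < M`, or `j = 0` and
`κ = k ∈ ℤ` with `0 < |k| < M`. [folklore] -/
theorem sum_charRef_eq_zero {M : ℕ} (hM : 0 < M) {j : ℤ} {κ : ℝ}
    (h : (j ≠ 0 ∧ j.natAbs < M) ∨ (j = 0 ∧ ∃ k : ℤ, (k : ℝ) = κ ∧ k ≠ 0 ∧ k.natAbs < M)) :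
    ∑ p ∈ Finset.range M ×ˢ Finset.range M,
      charRef j κ (((p.2 : ℝ) + 1) / M) (-Real.pi + 2 * Real.pi * (p.1 + 1) / M) = 0 := by
  have hMr : (M : ℝ) ≠ 0 := by positivity
  have hc : 2 * Real.pi / M * M = 2 * Real.pi := by field_simp
  rw [Finset.sum_product]
  simp only [charRef]
  simp_rw [← Finset.mul_sum, ← Finset.sum_mul]
  rcases h with ⟨hj, hjM⟩ | ⟨hj, k, hk, hk0, hkM⟩
  · -- the angular sum vanishes
    have hA : ∑ i ∈ Finset.range M,
        Complex.exp ((((j : ℝ) * (-Real.pi + 2 * Real.pi * ((i : ℕ) + 1) / M) : ℝ) : ℂ) * I) = 0 := by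
      have := sum_range_exp_eq_zero hj hjM (-Real.pi) hc
      convert this using 4
      ring
    rw [hA, zero_mul]
  · -- the radial sum vanishes
    have hB : ∑ l ∈ Finset.range M,
        Complex.exp (((-(2 * Real.pi * κ * ((((l : ℕ) : ℝ) + 1) / M)) : ℝ) : ℂ) * I) = 0 := by
      have hk0' : (-k) ≠ 0 := neg_ne_zero.2 hk0
      have hkM' : (-k).natAbs < M := by rwa [Int.natAbs_neg]
      have := sum_range_exp_eq_zero hk0' hkM' 0 hc
      convert this using 4
      rw [← hk]; push_cast; ring
    rw [hB, mul_zero]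

/-- Monotonicity of half-open cells in the box. [folklore] -/
theorem sectorIoc_mono {a b a' b' : ℝ × ℝ} (ha : a' ≤ a) (hb : b ≤ b') : sectorIoc a b ⊆ sectorIoc a' b' := by
  refine Set.image_mono (Set.prod_mono subset_rfl (Set.prod_mono ?_ ?_))
  · exact Set.Ioc_subset_Ioc (Prod.le_def.1 ha).1 (Prod.le_def.1 hb).1
  · exact Set.Ioc_subset_Ioc (Prod.le_def.1 ha).2 (Prod.le_def.1 hb).2

/-- The scaled translated fundamental region is bounded by a ball of radius proportional to the
scale. [folklore] -/
theorem isBounded_image_fundRegion (τ : ℝ) (hτ : 0 ≤ τ) (c : ℝ × ℂ) :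
    Bornology.IsBounded ((fun w ↦ τ • w + c) '' sectorIoc ((0 : ℝ), -Real.pi) (1, Real.pi)) := by
  obtain ⟨R, hR⟩ := (isBounded_sectorIoc ((0 : ℝ), -Real.pi) (1, Real.pi)).subset_closedBall 0
  refine (Metric.isBounded_closedBall (x := c) (r := τ * R)).subset ?_
  rintro _ ⟨w, hw, rfl⟩
  have hwR : ‖w‖ ≤ R := by simpa using hR hw
  rw [Metric.mem_closedBall, dist_eq_norm, add_sub_cancel_right, norm_smul, Real.norm_of_nonneg hτ]
  exact mul_le_mul_of_nonneg_left hwR hτ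

/-- **Per-cell estimates** for the twisted sum: the fibre of the cell index over `(i,l)` is counted by
the uniform sector count (with the common cell volume), and `ψ` varies by at most `2π(|j|+|κ|)/M` on
it. [folklore] -/
theorem cell_estimates {C₁ : ℝ}
    (hC₁ : ∀ a b : ℝ × ℝ, ((0 : ℝ), -Real.pi) ≤ a → a ≤ b → b ≤ ((1 : ℝ), Real.pi) →
      ∀ t : ℝ, 1 ≤ t → ∀ c : ℝ × ℂ,
        |(Nat.card (((fun w ↦ t • w + c) '' sectorIoc a b) ∩
              (span ℤ (Set.range basisW) : Set (ℝ × ℂ)) : Set (ℝ × ℂ)) : ℝ) -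
            volume.real (sector a b) / volume.real (ZSpan.fundamentalDomain basisW) * t ^ 3| ≤
          C₁ * t ^ 2)
    (j : ℤ) (κ : ℝ) {q : ℕ} (hq : 0 < q) (a : ℤ × ℤ × ℤ) {t : ℝ} (ht0 : 0 < t)
    {T : Finset (ℤ × ℤ × ℤ)}
    (hT : ∀ v, v ∈ T ↔ CongMod q a v ∧ embW (castVec v) ∈ t • sectorIoc ((0 : ℝ), -Real.pi) (1, Real.pi))
    {M : ℕ} (hM0 : 0 < M) {i l : ℕ} (hi : i < M) (hl : l < M) (hτ1 : 1 ≤ t / q) :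
    |((T.filter (fun v ↦ cellIdx M (embW (castVec v)) = (i, l))).card : ℝ) -
        volume.real (sector (cellLo M 0 0) (cellHi M 0 0)) / volume.real (ZSpan.fundamentalDomain basisW) *
          (t / q) ^ 3| ≤ max C₁ 0 * (t / q) ^ 2 ∧
    ‖∑ v ∈ T with cellIdx M (embW (castVec v)) = (i, l), charW j κ (embW (castVec v)) -
        charRef j κ (((l : ℝ) + 1) / M) (-Real.pi + 2 * Real.pi * (i + 1) / M) *
          (T.filter (fun v ↦ cellIdx M (embW (castVec v)) = (i, l))).card‖ ≤
      2 * Real.pi * (|(j : ℝ)| + |κ|) / M * (T.filter (fun v ↦ cellIdx M (embW (castVec v)) = (i, l))).card := by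
  classical
  have hb := cell_bounds hi hl
  set X : Set (ℝ × ℂ) := sectorIoc (cellLo M i l) (cellHi M i l) with hX
  have hXF : X ⊆ sectorIoc ((0 : ℝ), -Real.pi) (1, Real.pi) := sectorIoc_mono hb.1 hb.2.2
  set fib := T.filter (fun v ↦ cellIdx M (embW (castVec v)) = (i, l)) with hfibdef
  -- membership in the fibre = membership in `t • X`
  have hfib : ∀ v, v ∈ fib ↔ CongMod q a v ∧ embW (castVec v) ∈ t • X := by
    intro v
    rw [hfibdef, Finset.mem_filter, hT v]
    constructor
    · rintro ⟨⟨hcong, hw⟩, hid⟩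
      exact ⟨hcong, (cellIdx_eq_iff_mem_smul_cell ht0 hM0 hi hl hw).1 hid⟩
    · rintro ⟨hcong, hw⟩
      have hwF : embW (castVec v) ∈ t • sectorIoc ((0 : ℝ), -Real.pi) (1, Real.pi) :=
        Set.smul_set_mono hXF hw
      exact ⟨⟨hcong, hwF⟩, (cellIdx_eq_iff_mem_smul_cell ht0 hM0 hi hl hwF).2 hw⟩
  have hNeq : fib.card = Nat.card ↥(((fun w : ℝ × ℂ ↦ (t / q) • w + (-(1 / (q : ℝ))) • embW (castVec a)) '' X) ∩
      (span ℤ (Set.range basisW) : Set (ℝ × ℂ))) := by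
    rw [← card_cong_eq q hq a t X, ← Nat.card_eq_finsetCard]
    exact Nat.card_congr (Equiv.subtypeEquivRight (fun v ↦ hfib v))
  refine ⟨?_, ?_⟩
  · have h1 := hC₁ (cellLo M i l) (cellHi M i l) hb.1 hb.2.1 hb.2.2 (t / q) hτ1
      ((-(1 / (q : ℝ))) • embW (castVec a))
    have hvol : volume.real (sector (cellLo M i l) (cellHi M i l)) =
        volume.real (sector (cellLo M 0 0) (cellHi M 0 0)) := by
      rw [measureReal_def, measureReal_def, volume_sector_cell]
    rw [hvol, ← hNeq] at h1
    refine h1.trans ?_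
    gcongr
    exact le_max_left _ _
  · have hconst : charRef j κ (((l : ℝ) + 1) / M) (-Real.pi + 2 * Real.pi * (i + 1) / M) * (fib.card : ℂ) =
        ∑ v ∈ fib, charRef j κ (((l : ℝ) + 1) / M) (-Real.pi + 2 * Real.pi * (i + 1) / M) := by
      rw [Finset.sum_const, nsmul_eq_mul, mul_comm]
    rw [hconst, ← Finset.sum_sub_distrib]
    refine (norm_sum_le _ _).trans ?_
    have hterm : ∀ v ∈ fib, ‖charW j κ (embW (castVec v)) -
        charRef j κ (((l : ℝ) + 1) / M) (-Real.pi + 2 * Real.pi * (i + 1) / M)‖ ≤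
        2 * Real.pi * (|(j : ℝ)| + |κ|) / M := by
      intro v hv
      exact norm_charW_sub_charRef_cell ht0 hM0 hi hl j κ ((hfib v).1 hv).2
    refine (Finset.sum_le_sum hterm).trans ?_
    rw [Finset.sum_const, nsmul_eq_mul, mul_comm]

/-- The numerical endgame of the twisted-sum estimate. [folklore] -/
theorem twisted_endgame {K₀ C J s M τ Tc : ℝ} (hK₀ : 0 ≤ K₀) (hC : 0 ≤ C) (hJ : 0 ≤ J) (hs1 : 1 ≤ s)
    (hJs : J ≤ s ^ 2) (hsM : s ≤ M) (hMle : M ≤ s + J + 3) (hτs : τ ≤ s ^ 3) (hτ0 : 0 ≤ τ)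
    (hT : Tc ≤ K₀ * s ^ 9) :
    2 * Real.pi * J / M * Tc + M ^ 2 * (C * τ ^ 2) ≤ (2 * Real.pi * K₀ + 30 * C + K₀) * (1 + J) * s ^ 8 := by
  have hs0 : 0 < s := by linarith
  have hM0 : 0 < M := by linarith
  have hωT : 2 * Real.pi * J / M * Tc ≤ 2 * Real.pi * K₀ * J * s ^ 8 := by
    have hJM : 0 ≤ 2 * Real.pi * J / M := by positivity
    calc 2 * Real.pi * J / M * Tc ≤ 2 * Real.pi * J / M * (K₀ * s ^ 9) := by gcongr
      _ = 2 * Real.pi * K₀ * J * (s ^ 9 / M) := by ring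
      _ ≤ 2 * Real.pi * K₀ * J * s ^ 8 := by
          have h98 : s ^ 9 / M ≤ s ^ 8 := by
            rw [div_le_iff₀ hM0]
            calc s ^ 9 = s ^ 8 * s := by ring
              _ ≤ s ^ 8 * M := by gcongr
          have : 0 ≤ 2 * Real.pi * K₀ * J := by positivity
          exact mul_le_mul_of_nonneg_left h98 this
  have hM2 : M ^ 2 * (C * τ ^ 2) ≤ 30 * C * (1 + J) * s ^ 8 := by
    have hτ2 : τ ^ 2 ≤ s ^ 6 := by
      calc τ ^ 2 ≤ (s ^ 3) ^ 2 := by gcongr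
        _ = s ^ 6 := by ring
    have hs2 : 1 ≤ s ^ 2 := one_le_pow₀ hs1
    have hMsq : M ^ 2 ≤ 30 * (1 + J) * s ^ 2 := by
      calc M ^ 2 ≤ (s + J + 3) ^ 2 := by gcongr
        _ ≤ 3 * (s ^ 2 + J ^ 2 + 9) := by
            nlinarith [sq_nonneg (s - J), sq_nonneg (s - 3), sq_nonneg (J - 3)]
        _ ≤ 3 * (s ^ 2 + J * s ^ 2 + 9 * s ^ 2) := by nlinarith
        _ ≤ 30 * (1 + J) * s ^ 2 := by nlinarith [pow_pos hs0 2]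
    calc M ^ 2 * (C * τ ^ 2) ≤ (30 * (1 + J) * s ^ 2) * (C * s ^ 6) := by gcongr
      _ = 30 * C * (1 + J) * s ^ 8 := by ring
  have h8 : 0 < s ^ 8 := pow_pos hs0 8
  nlinarith [mul_nonneg hK₀ h8.le, mul_nonneg (mul_nonneg hK₀ hJ) h8.le, mul_nonneg hC h8.le, Real.pi_pos]

/-- **Twisted lattice sums over `ℚ(∛2)` (the input for Hecke–Mitsui `L`-functions).** There is an
absolute `C` such that for every character `ψ_{j,κ}` with `j ≠ 0`, or `j = 0` and `κ ∈ ℤ ∖ {0}`, every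
modulus `q ≥ 1`, every residue class `a ∈ ℤ³`, every `t ≥ 1` and the set `T` of `v ∈ ℤ³`,
`v ≡ a (mod q)`, whose embedding lies in `t·F` (`F` = norm `≤ 1`, unit coordinate in `(0,1]`, i.e.
the canonical generators of the ideals of norm `≤ t³` in the class),
`‖∑_{v ∈ T} ψ_{j,κ}(v)‖ ≤ C (1 + |j| + |κ|) t^{8/3}` — a power saving `x^{-1/9}` relative to the
trivial bound `x = t³`, uniformly in `q` and `a`. (Proof: grid of `M²` sectors, `M ≍ x^{1/9}`, the
uniform count `exists_uniform_sectorIoc_count`, equal volumes of the cells, and exact cancellation of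
the reference values over a full period.) [cite: HeathBrownActa2001, §9 Lemma 9.4 (input); Marcus2018, Ch. 6, Lemma 2] -/
theorem exists_twisted_sum_bound :
    ∃ C : ℝ, ∀ (j : ℤ) (κ : ℝ), (j ≠ 0 ∨ ∃ k : ℤ, (k : ℝ) = κ ∧ k ≠ 0) →
      ∀ (q : ℕ), 0 < q → ∀ (a : ℤ × ℤ × ℤ) (t : ℝ), 1 ≤ t →
        ∀ T : Finset (ℤ × ℤ × ℤ),
          (∀ v, v ∈ T ↔ CongMod q a v ∧
            embW (castVec v) ∈ t • sectorIoc ((0 : ℝ), -Real.pi) (1, Real.pi)) →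
          ‖∑ v ∈ T, charW j κ (embW (castVec v))‖ ≤ C * (1 + |(j : ℝ)| + |κ|) * t ^ (8 / 3 : ℝ) := by
  classical
  obtain ⟨C₁, hC₁⟩ := exists_uniform_sectorIoc_count
  set C₁' : ℝ := max C₁ 0 with hC₁'
  have hC₁'0 : 0 ≤ C₁' := le_max_right _ _
  have hC₁le : C₁ ≤ C₁' := le_max_left _ _
  set covol : ℝ := volume.real (ZSpan.fundamentalDomain basisW) with hcovol
  set F : Set (ℝ × ℂ) := sectorIoc ((0 : ℝ), -Real.pi) (1, Real.pi) with hF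
  set VF : ℝ := volume.real (sector ((0 : ℝ), -Real.pi) (1, Real.pi)) / covol with hVF
  have hVF0 : 0 ≤ VF := div_nonneg measureReal_nonneg measureReal_nonneg
  set K₀ : ℝ := VF + C₁' with hK₀
  have hK₀0 : 0 ≤ K₀ := add_nonneg hVF0 hC₁'0
  refine ⟨2 * Real.pi * K₀ + 30 * C₁' + K₀, ?_⟩
  intro j κ hjk q hq a t ht T hT
  have ht0 : 0 < t := by linarith
  have hqr : (0 : ℝ) < q := by exact_mod_cast hq
  have hq1 : (1 : ℝ) ≤ q := by exact_mod_cast hq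
  have hFbox : ((0 : ℝ), -Real.pi) ≤ ((1 : ℝ), Real.pi) := by
    rw [Prod.le_def]; exact ⟨zero_le_one, by linarith [Real.pi_pos]⟩
  -- `J`, `s = t^{1/3}`
  set J : ℝ := |(j : ℝ)| + |κ| with hJ
  have hJ0 : 0 ≤ J := by positivity
  set s : ℝ := t ^ ((1 : ℝ) / 3) with hs
  have hs1 : 1 ≤ s := Real.one_le_rpow ht (by norm_num)
  have hs0 : 0 < s := by linarith
  have hs3 : s ^ 3 = t := by
    rw [hs, ← Real.rpow_natCast, ← Real.rpow_mul ht0.le]; norm_num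
  have ht83 : t ^ (8 / 3 : ℝ) = s ^ 8 := by
    rw [hs, ← Real.rpow_natCast, ← Real.rpow_mul ht0.le]; norm_num
  rw [ht83]
  have h1J : 1 ≤ (1 + J) * s ^ 8 := by nlinarith [one_le_pow₀ (n := 8) hs1]
  have hCK : K₀ ≤ 2 * Real.pi * K₀ + 30 * C₁' + K₀ := by nlinarith [Real.pi_pos]
  -- the scale `τ = t/q` and the translation
  set τ : ℝ := t / q with hτ
  have hτ0 : 0 < τ := div_pos ht0 hqr
  set c : ℝ × ℂ := (-(1 / (q : ℝ))) • embW (castVec a) with hc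
  -- `#T` as a lattice count
  have hcardT : T.card = Nat.card ↥(((fun w : ℝ × ℂ ↦ τ • w + c) '' F) ∩
      (span ℤ (Set.range basisW) : Set (ℝ × ℂ))) := by
    rw [← card_cong_eq q hq a t F, ← Nat.card_eq_finsetCard]
    exact Nat.card_congr (Equiv.subtypeEquivRight (fun v ↦ hT v))
  -- the trivial bound
  have htriv : ‖∑ v ∈ T, charW j κ (embW (castVec v))‖ ≤ T.card := by
    refine (norm_sum_le _ _).trans ?_
    simp [norm_charW]
  by_cases htq : t < q
  · -- `τ < 1`: everything sits in one translate of `F`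
    have hτ1 : τ ≤ 1 := by rw [hτ, div_le_one hqr]; exact htq.le
    have hsub : (fun w : ℝ × ℂ ↦ τ • w + c) '' F ⊆ (fun w : ℝ × ℂ ↦ (1 : ℝ) • w + c) '' F := by
      rintro _ ⟨w, hw, rfl⟩
      exact ⟨τ • w, smul_fundRegion_subset hτ0 hτ1 (Set.smul_mem_smul_set hw), by simp⟩
    have hfin := ZSpan.setFinite_inter basisW (isBounded_image_fundRegion 1 zero_le_one c)
    have hmono := Nat.card_mono hfin (Set.inter_subset_inter_left _ hsub)
    have h1 := hC₁ ((0 : ℝ), -Real.pi) (1, Real.pi) le_rfl hFbox le_rfl 1 le_rfl c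
    rw [one_pow, one_pow, mul_one, mul_one] at h1
    have hN1 : (Nat.card ↥(((fun w : ℝ × ℂ ↦ (1 : ℝ) • w + c) '' F) ∩
        (span ℤ (Set.range basisW) : Set (ℝ × ℂ))) : ℝ) ≤ K₀ := by
      have := (abs_le.1 h1).2
      rw [hK₀]; linarith
    calc ‖∑ v ∈ T, charW j κ (embW (castVec v))‖ ≤ T.card := htriv
      _ ≤ K₀ := by rw [hcardT]; exact le_trans (by exact_mod_cast hmono) hN1
      _ ≤ (2 * Real.pi * K₀ + 30 * C₁' + K₀) * 1 := by linarith
      _ ≤ (2 * Real.pi * K₀ + 30 * C₁' + K₀) * ((1 + J) * s ^ 8) := by gcongr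
      _ = _ := by ring
  -- `τ ≥ 1`
  rw [not_lt] at htq
  have hτ1 : 1 ≤ τ := by rw [hτ, le_div_iff₀ hqr, one_mul]; exact htq
  have hτt : τ ≤ t := by rw [hτ]; exact div_le_self ht0.le hq1
  have hτs : τ ≤ s ^ 3 := hs3 ▸ hτt
  have hTK : (T.card : ℝ) ≤ K₀ * τ ^ 3 := by
    have h1 := hC₁ ((0 : ℝ), -Real.pi) (1, Real.pi) le_rfl hFbox le_rfl τ hτ1 c
    have := (abs_le.1 h1).2
    rw [hcardT, hK₀]
    have hτ23 : τ ^ 2 ≤ τ ^ 3 := pow_le_pow_right₀ hτ1 (by norm_num)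
    nlinarith [hC₁le, hτ23]
  have hT9 : (T.card : ℝ) ≤ K₀ * s ^ 9 := by
    refine hTK.trans ?_
    calc K₀ * τ ^ 3 ≤ K₀ * (s ^ 3) ^ 3 := by gcongr
      _ = K₀ * s ^ 9 := by ring
  by_cases hJs : s ^ 2 < J
  · -- huge frequencies: trivial bound
    have hs9 : s ^ 9 ≤ (1 + J) * s ^ 8 := by
      have : s ≤ 1 + J := by nlinarith
      nlinarith [pow_pos hs0 8]
    calc ‖∑ v ∈ T, charW j κ (embW (castVec v))‖ ≤ T.card := htriv
      _ ≤ K₀ * s ^ 9 := hT9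
      _ ≤ K₀ * ((1 + J) * s ^ 8) := by gcongr
      _ ≤ (2 * Real.pi * K₀ + 30 * C₁' + K₀) * ((1 + J) * s ^ 8) := by gcongr
      _ = _ := by ring
  rw [not_lt] at hJs
  -- the grid size
  set M : ℕ := ⌈s⌉₊ + j.natAbs + ⌈|κ|⌉₊ + 1 with hM
  have hM0 : 0 < M := by omega
  have hMr : (0 : ℝ) < M := by exact_mod_cast hM0
  have hjabs : ((j.natAbs : ℕ) : ℝ) = |(j : ℝ)| := by rw [Nat.cast_natAbs, Int.cast_abs]
  have hsM : s ≤ M := by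
    rw [hM]; push_cast
    have h1 := Nat.le_ceil s
    have h2 : (0 : ℝ) ≤ (j.natAbs : ℝ) := by positivity
    have h3 : (0 : ℝ) ≤ (⌈|κ|⌉₊ : ℝ) := by positivity
    linarith
  have hjM : j.natAbs < M := by omega
  have hMle : (M : ℝ) ≤ s + J + 3 := by
    rw [hM, hJ]; push_cast
    have h1 := (Nat.ceil_lt_add_one hs0.le).le
    have h2 := (Nat.ceil_lt_add_one (abs_nonneg κ)).le
    linarith
  have hkM : ∀ k : ℤ, (k : ℝ) = κ → k.natAbs < M := by
    intro k hk
    have h3 : ((k.natAbs : ℕ) : ℝ) = |(k : ℝ)| := by rw [Nat.cast_natAbs, Int.cast_abs]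
    have : (k.natAbs : ℝ) ≤ ⌈|κ|⌉₊ := by rw [h3, hk]; exact Nat.le_ceil _
    have : k.natAbs ≤ ⌈|κ|⌉₊ := by exact_mod_cast this
    omega
  -- the index map and the fibre decomposition
  set P : Finset (ℕ × ℕ) := Finset.range M ×ˢ Finset.range M with hP
  have hmaps : ∀ v ∈ T, cellIdx M (embW (castVec v)) ∈ P := by
    intro v hv
    have hw := ((hT v).1 hv).2
    have hpos := pos_of_mem_smul_fundRegion ht0 hw
    rw [Set.mem_smul_set_iff_inv_smul_mem₀ ht0.ne'] at hw
    have := cellIdx_mem hM0 hw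
    rwa [cellIdx_smul (inv_pos.2 ht0) hpos.1 hpos.2] at this
  have hdecomp : ∑ v ∈ T, charW j κ (embW (castVec v)) =
      ∑ p ∈ P, ∑ v ∈ T with cellIdx M (embW (castVec v)) = p, charW j κ (embW (castVec v)) :=
    (Finset.sum_fiberwise_of_maps_to hmaps _).symm
  have hcardsum : T.card = ∑ p ∈ P, (T.filter (fun v ↦ cellIdx M (embW (castVec v)) = p)).card :=
    Finset.card_eq_sum_card_fiberwise hmaps
  -- reference values and common volume
  set ψref : ℕ × ℕ → ℂ := fun p ↦
    charRef j κ (((p.2 : ℝ) + 1) / M) (-Real.pi + 2 * Real.pi * (p.1 + 1) / M) with hψref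
  set V : ℝ := volume.real (sector (cellLo M 0 0) (cellHi M 0 0)) / covol with hV
  set ω : ℝ := 2 * Real.pi * J / M with hω
  have hcancel : ∑ p ∈ P, ψref p = 0 := by
    refine sum_charRef_eq_zero hM0 ?_
    rcases hjk with hj | ⟨k, hk, hk0⟩
    · exact Or.inl ⟨hj, hjM⟩
    · by_cases hj : j = 0
      · exact Or.inr ⟨hj, k, hk, hk0, hkM k hk⟩
      · exact Or.inl ⟨hj, hjM⟩
  -- assembly
  have hmain : ‖∑ v ∈ T, charW j κ (embW (castVec v))‖ ≤ ω * T.card + (M : ℝ) ^ 2 * (C₁' * τ ^ 2) := by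
    rw [hdecomp]
    have hrw : ∑ p ∈ P, ∑ v ∈ T with cellIdx M (embW (castVec v)) = p, charW j κ (embW (castVec v)) =
        ∑ p ∈ P, (∑ v ∈ T with cellIdx M (embW (castVec v)) = p, charW j κ (embW (castVec v)) -
          ψref p * (V * τ ^ 3 : ℝ)) := by
      rw [Finset.sum_sub_distrib, ← Finset.sum_mul, hcancel, zero_mul, sub_zero]
    rw [hrw]
    refine (norm_sum_le _ _).trans ?_
    have hle : ∀ p ∈ P, ‖∑ v ∈ T with cellIdx M (embW (castVec v)) = p, charW j κ (embW (castVec v)) -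
        ψref p * (V * τ ^ 3 : ℝ)‖ ≤
        ω * (T.filter (fun v ↦ cellIdx M (embW (castVec v)) = p)).card + C₁' * τ ^ 2 := by
      rintro ⟨i, l⟩ hp
      have hp' := hp
      rw [hP, Finset.mem_product, Finset.mem_range, Finset.mem_range] at hp'
      obtain ⟨hN, hS⟩ := cell_estimates hC₁ j κ hq a ht0 hT hM0 hp'.1 hp'.2 hτ1
      set Np := (T.filter (fun v ↦ cellIdx M (embW (castVec v)) = (i, l))).card
      have hsplit : ∑ v ∈ T with cellIdx M (embW (castVec v)) = (i, l), charW j κ (embW (castVec v)) -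
          ψref (i, l) * (V * τ ^ 3 : ℝ) =
          (∑ v ∈ T with cellIdx M (embW (castVec v)) = (i, l), charW j κ (embW (castVec v)) -
            ψref (i, l) * (Np : ℂ)) + ψref (i, l) * ((Np : ℝ) - V * τ ^ 3 : ℝ) := by
        push_cast; ring
      rw [hsplit]
      refine (norm_add_le _ _).trans (add_le_add hS ?_)
      rw [norm_mul, hψref, norm_charRef, one_mul, Complex.norm_real, Real.norm_eq_abs]
      exact hN
    refine (Finset.sum_le_sum hle).trans (le_of_eq ?_)
    rw [Finset.sum_add_distrib, ← Finset.mul_sum, Finset.sum_const, nsmul_eq_mul, hcardsum]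
    push_cast
    rw [hP, Finset.card_product, Finset.card_range]
    push_cast; ring
  refine hmain.trans ?_
  rw [hω, show (1 : ℝ) + |(j : ℝ)| + |κ| = 1 + J by rw [hJ]; ring]
  exact twisted_endgame hK₀0 hC₁'0 hJ0 hs1 hJs hsM hMle hτs hτ0.le hT9

end Literature.NumberTheory.Sieve.CubicSieve
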